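import Summits.ABC.IUTFork.Joshi.GeometricCase2

/-!
# Joshi's geometric case II — proof-only companion (arXiv:2401.13508 v4, §§12.9–12.18): kernel facts about the typed
# signature of `Joshi/GeometricCase2.lean` — no new definitions, no side taken

Record file of the abc-iut cell, branch E (rung LADDER-ABC:A2.E; seat abc-iut-E-t36, slot T-36). Everything here is DERIVED from
the typed signature of `Joshi/GeometricCase2.lean` (bib `Joshi2024ATS3`, UNREFEREED, disputed in print: `Mochizuki2024JoshiReport`);
nothing is asserted about [IUTchIII] Cor. 3.12, about abc, or about the correctness of any author. Contents:
* small closure facts: `ϕ∞` lies over `1` and in `S̃L₂(ℤ) ⊆ S̃L₂(ℚ)`; lifts lie in `S̃L₂(ℤ)`; Lemma 12.10.2's tuple map is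
  injective; `|Θ_classical(D)| = ⊥` (the documented `EReal` junk value) iff `Θ_classical(D) = ∅`.
* §12.9 DISCHARGED (p. 151 l. 34–46: «`SL₂(ℚ)`, `S̃L₂(ℚ)` are both countable … Choose an enumerating function»): the chosen
  enumerations `θ_n`, `θ_{n,m}` with `θ_{n,m} ↦ θ_n` EXIST over the typed signature (`HeightDatum.nonempty_logThetaLattice`).
* LOCATED (L3) made kernel-hard: in the VERBATIM form of Thm. 12.18.1 the binder «any choice of `(g̃_1,…,g̃_{ℓ*}) ∈ Θ_classical(D)`»
  is idle once `Θ_classical(D) ≠ ∅` (`thm12181AsPrinted_iff`); the first inequality forces `Θ_classical(D) ≠ ∅`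
  (`carrier_nonempty_of_thm12181`); and a two-line MODEL of the signature (`Y = SL₂(ℝ) × ℤ`, `h(A,k) = π·k`, one singular fibre,
  trivial monodromy) satisfies (12.14.1) ∧ (12.15.1) with `Θ_classical(D) ≠ ∅` and yet VIOLATES the verbatim Thm. 12.18.1
  (`asPrinted_not_derivable`) — whereas OUR READING (membership of the lift family) is a theorem of (12.14.1) alone
  (`HeightDatum.thm12181Reading_of_subadditive`, main file). So the displayed statement is carried by the MEMBERSHIP its proof
  uses («`|Θ_classical(D)|` is the supremum of all such sums», p. 156 l. 47–49) — the geometric analogue of the cell's residual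
  `Summit.ABC.IUTFork.Cor312Vol.PilotKummerIndRelated`. Located, not adjudicated; the model is a model of OUR TYPING, not of
  Zhang's `S̃L₂(ℝ)`.
* LOCATED (L4): (12.15.1) as printed, `h(g̃·ϕ∞^m) ≤ h(g̃) + π·m` for all `m ∈ ℤ`, is EQUIVALENT to exact additivity
  `h(g̃·ϕ∞^m) = h(g̃) + π·m` (`heightLogLinkBound_iff_additive`; apply the bound to `m` and to `−m`) — presumably `m ≥ 0` is meant
  (p. 155 l. 9: «for `m ∈ ℤ`»); typed as printed, recorded here.
* The signature is satisfiable together with (12.14.1) ∧ (12.15.1) (`signature_satisfiable`) — a non-vacuity check of the typing,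
  nothing more. [claim: Joshi2024ATS3, status: disputed]
-/

noncomputable section

open scoped MatrixGroups

namespace Summit.ABC.IUTFork.Joshi.ATS3.GeoLocus

namespace HeightDatum

variable {Y : Type} [Group Y] (G : HeightDatum Y)

/-- `ϕ∞` lies over `1 ∈ SL₂(ℝ)` ((12.3.1): `ϕ∞ = z²` is in the kernel). [folklore] -/
theorem proj_frob : G.proj G.frob = 1 := by
  have : G.frob ∈ G.proj.ker := by rw [G.ker_proj]; exact Subgroup.mem_zpowers _
  exact (MonoidHom.mem_ker).1 this

/-- `ϕ∞ ∈ S̃L₂(ℤ)` (so chains of log-links `g̃·ϕ∞^n`, Def. 12.6.1, stay inside `S̃L₂(ℤ)` and `S̃L₂(ℚ)`). [folklore] -/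
theorem frob_mem_intl : G.frob ∈ G.intl := by
  refine Subgroup.mem_comap.2 ?_
  rw [G.proj_frob]
  exact one_mem _

/-- `S̃L₂(ℤ) ⊆ S̃L₂(ℚ)`. [folklore] -/
theorem intl_le_ratl : G.intl ≤ G.ratl := by
  rintro g ⟨B, hB⟩
  refine ⟨Matrix.SpecialLinearGroup.map (Int.castRingHom ℚ) B, ?_⟩
  rw [← hB]
  ext i j
  simp [Matrix.SpecialLinearGroup.map]

/-- A lift (§12.17) lies in `S̃L₂(ℤ)`. [folklore] -/
theorem IsLiftOf.mem_intl {g : Y} {A : SL(2, ZMod G.ell)} (hg : G.IsLiftOf g A) : g ∈ G.intl := by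
  obtain ⟨B, hB, -⟩ := hg
  exact ⟨B, hB.symm⟩

/-- LOCATED (L4): (12.15.1) as printed (all `m ∈ ℤ`) is equivalent to EXACT additivity of `h` along chains of log-links.
[folklore] -/
theorem heightLogLinkBound_iff_additive :
    G.HeightLogLinkBound ↔ ∀ (g : Y) (m : ℤ), G.h (g * G.frob ^ m) = G.h g + Real.pi * m := by
  constructor
  · intro hb g m
    refine le_antisymm (hb g m) ?_
    have := hb (g * G.frob ^ m) (-m)
    rw [mul_assoc, ← zpow_add, add_neg_cancel, zpow_zero, mul_one, Int.cast_neg, mul_neg] at this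
    linarith
  · intro heq g m
    exact (heq g m).le

/-- DERIVED — §12.9's «`SL₂(ℚ)`, `S̃L₂(ℚ)` are both countable sets and hence so are `SL₂(ℚ)^{ℓ*}` and `S̃L₂(ℚ)^{ℓ*}`. Choose an
enumerating function …» (p. 151 l. 34–46): over the typed signature an enumeration `θ_n` of `SL₂(ℚ)^{ℓ*}` and a compatible
enumeration `θ_{n,m}` of `S̃L₂(ℚ)^{ℓ*}` (`θ_{n,m} ↦ θ_n`) EXIST — `S̃L₂(ℚ)^{ℓ*}` is countable because each fibre of `Y∞ → X∞` is a
`⟨ϕ∞⟩`-coset. (Countable choice; the enumerations need not be injective, as in print.) [folklore] -/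
theorem nonempty_logThetaLattice : Nonempty G.LogThetaLattice := by
  classical
  haveI : Countable (SL(2, ℚ)) :=
    Function.Injective.countable (f := fun (A : SL(2, ℚ)) (i j : Fin 2) => (A : Matrix (Fin 2) (Fin 2) ℚ) i j)
      fun A B hAB => Matrix.SpecialLinearGroup.ext A B fun i j => congrFun (congrFun hAB i) j
  obtain ⟨e0, he0⟩ := exists_surjective_nat (Fin G.lstar → SL(2, ℚ))
  obtain ⟨s0, hs0⟩ := exists_surjective_nat (Fin G.lstar → ℤ)
  have htoNat : Function.Surjective Int.toNat := fun k => ⟨k, Int.toNat_natCast k⟩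
  have he : Function.Surjective (fun n : ℤ => e0 n.toNat) := he0.comp htoNat
  have hs : Function.Surjective (fun m : ℤ => s0 m.toNat) := hs0.comp htoNat
  choose lift hlift using fun B : SL(2, ℚ) => G.proj_surjective (Matrix.SpecialLinearGroup.map (Rat.castHom ℝ) B)
  have hproj : ∀ (B : SL(2, ℚ)) (k : ℤ), G.proj (lift B * G.frob ^ k) = Matrix.SpecialLinearGroup.map (Rat.castHom ℝ) B := by
    intro B k
    rw [map_mul, map_zpow, G.proj_frob, one_zpow, mul_one, hlift]
  refine ⟨{ thetaBase := fun n => e0 n.toNat, thetaBase_surjective := he,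
            theta := fun nm j => lift (e0 nm.1.toNat j) * G.frob ^ (s0 nm.2.toNat j),
            theta_mem := fun nm j => Subgroup.mem_comap.2 ⟨e0 nm.1.toNat j, (hproj _ _).symm⟩,
            theta_surjective := ?_, proj_theta := fun n m j => hproj _ _ }⟩
  intro g hg
  choose B hB using fun j => MonoidHom.mem_range.1 (Subgroup.mem_comap.1 (hg j))
  obtain ⟨n, hn⟩ := he B
  have hk : ∀ j, ∃ k : ℤ, g j = lift (B j) * G.frob ^ k :=
    fun j => G.exists_zpow_frob_of_proj_eq (by rw [hlift, hB])
  choose k hk using hk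
  obtain ⟨m, hm⟩ := hs k
  refine ⟨(n, m), funext fun j => ?_⟩
  simp only at hn hm
  rw [hn, hm, ← hk]

namespace DomainLocus

variable {G} {n : ℕ} (L : G.DomainLocus n)

/-- `|Θ_classical(D)| = ⊥` in `EReal` iff `Θ_classical(D)` is empty (the documented junk value of Def. 12.16.1 as typed).
[folklore] -/
theorem size_eq_bot_iff : L.size = ⊥ ↔ L.carrier = ∅ := by
  constructor
  · intro h
    by_contra hne
    obtain ⟨g, hg⟩ := Set.nonempty_iff_ne_empty.2 hne
    have := L.hSum_le_size hg
    rw [h, le_bot_iff] at this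
    exact EReal.coe_ne_bot _ this
  · intro h
    simp [size, h]

end DomainLocus

/-- The first inequality of Thm. 12.18.1 FORCES `Θ_classical(D) ≠ ∅`: for an empty locus no lift family satisfies it
(membership, not (12.14.1), carries the inequality). [folklore] -/
theorem carrier_nonempty_of_thm12181 {n : ℕ} (L : G.DomainLocus n) {γt : Fin n → Fin G.lstar → Y}
    (hyp : G.Thm12181 L γt) : L.carrier.Nonempty := by
  by_contra hne
  have hbot : L.size = ⊥ := L.size_eq_bot_iff.2 (Set.not_nonempty_iff_eq_empty.1 hne)
  have := hyp.1
  rw [hbot, le_bot_iff] at this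
  exact EReal.coe_ne_bot _ this

/-- LOCATED (L3): in the verbatim form of Thm. 12.18.1 the binder «`(g̃_1,…,g̃_{ℓ*}) ∈ Θ_classical(D)`» is idle — once
`Θ_classical(D) ≠ ∅` the displayed statement says that EVERY lift family satisfies the two inequalities, member or not. [folklore] -/
theorem thm12181AsPrinted_iff {Pi : Type} [Group Pi] {genus n : ℕ} (L : G.DomainLocus n) (M : MonodromyDatum Pi genus n)
    (hne : L.carrier.Nonempty) :
    G.Thm12181AsPrinted L M ↔ ∀ γt : Fin n → Fin G.lstar → Y, M.IsLiftFamily G γt → G.Thm12181 L γt := by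
  obtain ⟨g₀, hg₀⟩ := hne
  exact ⟨fun hyp γt hγ => hyp g₀ hg₀ γt hγ, fun hyp _ _ γt hγ => hyp γt hγ⟩

/-- The verbatim form implies OUR READING (which only adds the membership hypothesis). [folklore] -/
theorem thm12181Reading_of_asPrinted {Pi : Type} [Group Pi] {genus n : ℕ} (L : G.DomainLocus n)
    (M : MonodromyDatum Pi genus n) (hyp : G.Thm12181AsPrinted L M) : G.Thm12181Reading L M :=
  fun γt hγ hmem => hyp γt hmem γt hγ

end HeightDatum

namespace SchottkyHodgeDatum

/-- Lemma 12.10.2's tuple map is injective: distinct tuples of Schottky parameters give distinct tuples of Hodge structures.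
[folklore] -/
theorem schottkyTuple_injective {Ext1 : Type} (H : SchottkyHodgeDatum Ext1) {ι : Type} :
    Function.Injective (H.schottkyTuple (ι := ι)) := by
  intro q q' hqq'
  funext j
  have := congrArg (fun x => H.deligne (x j)) hqq'
  simpa [deligne_schottkyTuple] using this

end SchottkyHodgeDatum

/-! ## A two-line model of the typed signature (non-vacuity; necessity of membership) -/

namespace Model

/-- The toy carrier `Y = SL₂(ℝ) × ℤ` (written multiplicatively): `proj` = first projection, `ϕ∞ = (1, 1)`, `h(A, k) = π·k`,
`ℓ* = 2` (`ℓ = 5`), «provides» never holds. A model of OUR TYPING `HeightDatum` only — not of `S̃L₂(ℝ)` (which is a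
non-split extension). [folklore] -/
theorem exists_model :
    ∃ G : HeightDatum (SL(2, ℝ) × Multiplicative ℤ),
      G.HeightSubadditive ∧ G.HeightLogLinkBound ∧ G.lstar = 2 ∧
      (∀ x, G.h x = Real.pi * (Multiplicative.toAdd x.2 : ℤ)) ∧ G.frob = (1, Multiplicative.ofAdd 1) ∧
      (∀ x, G.proj x = x.1) ∧ (∀ g τ, ¬ G.Provides g τ) := by
  have h2 : ∀ m : ℤ, (((1, Multiplicative.ofAdd 1) : SL(2, ℝ) × Multiplicative ℤ) ^ m).2 = Multiplicative.ofAdd m :=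
    fun m => by change Multiplicative.ofAdd (1 : ℤ) ^ m = _; rw [← ofAdd_zsmul, smul_eq_mul, mul_one]
  have h1 : ∀ m : ℤ, (((1, Multiplicative.ofAdd 1) : SL(2, ℝ) × Multiplicative ℤ) ^ m).1 = 1 :=
    fun m => by change (1 : SL(2, ℝ)) ^ m = 1; exact one_zpow m
  have hker : (MonoidHom.fst (SL(2, ℝ)) (Multiplicative ℤ)).ker =
      Subgroup.zpowers ((1, Multiplicative.ofAdd 1) : SL(2, ℝ) × Multiplicative ℤ) := by
    ext x
    rw [MonoidHom.mem_ker, MonoidHom.coe_fst, Subgroup.mem_zpowers_iff]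
    constructor
    · intro hx
      exact ⟨Multiplicative.toAdd x.2, Prod.ext ((h1 _).trans hx.symm) (by rw [h2, ofAdd_toAdd])⟩
    · rintro ⟨k, rfl⟩
      exact h1 k
  let G : HeightDatum (SL(2, ℝ) × Multiplicative ℤ) :=
    { lstar := 2
      two_le_lstar := le_rfl
      ell_prime := Nat.prime_five
      proj := MonoidHom.fst (SL(2, ℝ)) (Multiplicative ℤ)
      proj_surjective := fun A => ⟨(A, 1), rfl⟩
      frob := (1, Multiplicative.ofAdd 1)
      frob_comm := fun g => Prod.ext (by simp) (mul_comm _ _)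
      ker_proj := hker
      h := fun x => Real.pi * (Multiplicative.toAdd x.2 : ℤ)
      Provides := fun _ _ => False }
  refine ⟨G, ?_, ?_, rfl, fun _ => rfl, rfl, fun _ => rfl, fun _ _ h => h⟩
  · intro x y
    simp only [G, Prod.snd_mul, toAdd_mul, Int.cast_add, mul_add, le_refl]
  · intro g m
    simp only [G, Prod.snd_mul, toAdd_mul, h2, toAdd_ofAdd, Int.cast_add, mul_add, le_refl]

/-- Non-vacuity of the typing: the signature `HeightDatum` together with (12.14.1) and (12.15.1) has a model. [folklore] -/
theorem signature_satisfiable :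
    ∃ G : HeightDatum (SL(2, ℝ) × Multiplicative ℤ), G.HeightSubadditive ∧ G.HeightLogLinkBound :=
  let ⟨G, h1, h2, _⟩ := exists_model
  ⟨G, h1, h2⟩

/-- LOCATED (L3) as a kernel witness: (12.14.1) ∧ (12.15.1) ∧ `Θ_classical(D) ≠ ∅` do NOT imply the verbatim Thm. 12.18.1 — in
the toy model with one singular fibre, trivial monodromy (`π₁ = 1`, genus `0`) and `Θ_classical(D) = {the identity family}`
(size `0`), the lift family `γ̃_s^{(j)} = (1, 1)` (a lift of `ρ_ℓ(γ_s)^{j²} = 1`) has `∑ h = 2π > 0 = |Θ_classical(D)|`. OUR READING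
(membership of the lift family) holds there, as everywhere under (12.14.1) (`thm12181Reading_of_subadditive`). [folklore] -/
theorem asPrinted_not_derivable :
    ∃ (G : HeightDatum (SL(2, ℝ) × Multiplicative ℤ)) (L : G.DomainLocus 1) (M : MonodromyDatum Unit 0 1),
      G.HeightSubadditive ∧ G.HeightLogLinkBound ∧ L.carrier.Nonempty ∧ G.Thm12181Reading L M ∧
      ¬ G.Thm12181AsPrinted L M := by
  obtain ⟨G, hsub, hll, hl, hh, hfrob, hproj, hprov⟩ := exists_model
  let γ0 : Fin 1 → Fin G.lstar → SL(2, ℝ) × Multiplicative ℤ := fun _ _ => 1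
  let γ1 : Fin 1 → Fin G.lstar → SL(2, ℝ) × Multiplicative ℤ := fun _ _ => G.frob
  let L : G.DomainLocus 1 :=
    { centre := fun _ => UpperHalfPlane.I, carrier := {γ0},
      thetaClassical_subset := fun g hg => (hprov (g 0) _ (hg 0).2).elim }
  let M : MonodromyDatum Unit 0 1 :=
    { a := Fin.elim0, b := Fin.elim0, loop := fun _ => (), closure_eq_top := Subsingleton.elim _ _,
      relation := Subsingleton.elim _ _, rho := 1 }
  refine ⟨G, L, M, hsub, hll, ⟨γ0, rfl⟩, G.thm12181Reading_of_subadditive hsub Nat.one_pos L M, fun hyp => ?_⟩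
  have hlift : M.IsLiftFamily G γ1 := by
    intro s j
    refine ⟨1, ?_, ?_⟩
    · rw [map_one, hproj]
      change (G.frob).1 = 1
      rw [hfrob]
    · rw [map_one]
      simp [MonodromyDatum.rhoL, M]
  have h1 : G.Thm12181 L γ1 := hyp γ0 rfl γ1 hlift
  have hsize : L.size = ((0 : ℝ) : EReal) := by
    have : L.size = ((G.hSum γ0 : ℝ) : EReal) := by
      simp [HeightDatum.DomainLocus.size, L]
    rw [this]
    congr 1
    simp [HeightDatum.hSum, γ0, hh]
  have hsum : G.hSum γ1 = Real.pi * (2 : ℝ) := by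
    simp [HeightDatum.hSum, γ1, hh, hfrob, hl, Finset.sum_const]
    ring
  have := h1.1
  rw [hsize, hsum, EReal.coe_le_coe_iff] at this
  have hpi := Real.pi_pos
  linarith

end Model

/-! ## Appended 2026-08-26 (referee NOTE E-ref-2 13:24:29Z on p431821: quote Rmk. 12.14.2 at a declaration) -/

namespace HeightDatum

variable {Y : Type} [Group Y] (G : HeightDatum Y)

/-- DERIVED — the AVERAGED display of §12.14 (p. 154 l. 29–41): «In particular one can also consider the average
`(1/ℓ*) ∑_{s∈S} h(g̃_{s,1}·g̃_{s,2}⋯g̃_{s,ℓ*}) ≤ (1/ℓ*) ∑_{s∈S} ∑_{j=1}^{ℓ*} h(g̃_j)`», on which **Remark 12.14.2** (p. 154 l. 42 –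
p. 155 l. 1) comments: «The proof of [Zhang, 2001], [Amorós et al., 2000] (and [Mochizuki, 2016]) can be understood as a sort of
averaging over `S̃L₂(ℤ)`. In what I do here, this averaging is being replaced here by averaging over `S̃L₂(ℚ)^{ℓ*}`. The
innovation presented here is the idea of averaging over `S̃L₂(ℚ)^{ℓ*}` which is not considered in [Mochizuki, 2016]–but
corresponds to working simultaneously with Mochizuki's Θgau-Links, and log-links ([Mochizuki, 2021c]).» (comparative prose,
no assertion; our side's analogue of the `1/ℓ*`: the procession-normalised averages of `Summit.ABC.IUTFork.Cor312.Setting`).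
The inequality itself is (12.14.1) summed and divided by `ℓ* > 0`. [folklore] -/
theorem prodSum_div_lstar_le_hSum_div_lstar (hsub : G.HeightSubadditive) {n : ℕ} (g : Fin n → Fin G.lstar → Y) :
    G.prodSum g / (G.lstar : ℝ) ≤ G.hSum g / (G.lstar : ℝ) :=
  div_le_div_of_nonneg_right (G.prodSum_le_hSum hsub g) (Nat.cast_nonneg _)

end HeightDatum

end Summit.ABC.IUTFork.Joshi.ATS3.GeoLocus
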